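import Mathlib

/-!
# SoloInformedDihedralSign — the sign lemma behind the class-number shadow of the unit symbol (Part II §7.11 (14))

Setting of Part II §7.11 (14): `F` totally real cubic, `p = 5`, `F' = F(μ₅)`, `ε` a unit of `F`,
`L = F'(ε^{1/5})` with `G = Gal(L/F') = ⟨σ⟩` cyclic of order `5`, and `τ̃ ∈ Gal(L/F(√5))` a reflection:
`τ̃ σ τ̃⁻¹ = σ⁻¹`, `τ̃² = 1`, with fixed field the degree-30 field `K_ε = F(√5, ε^{1/5})`.  On the
`5`-part `A` of the `S`-class group of `L` (`S` = primes above `5`) the `τ̃`-fixed part is the `5`-part of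
the `S`-class group of `K_ε`.  The CLASS-NUMBER SHADOW of §7.11 (14) rests on McCallum–Sharifi's genus
theory (Duke 2003, §6: `A/(σ-1)A ≅ A_{F'}` and Cor. 6.4) together with the following piece of pure algebra,
proved here with no number theory:

* `soloInformed_dihedral_sign` : if `τ` acts as `-1` on an additive commutative group `A`, conjugates an
  automorphism `σ` into its inverse, and `σ` has odd order, then `σ = 1` on `A`.
* `soloInformed_sigma_trivial_of_no_fixed_vector` : the same conclusion if `τ` is an involution WITHOUT
  non-zero fixed vector (then `a + τ a` is fixed, hence `0`, so `τ = -1`).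
* `soloInformed_exists_fixed_vector` : contrapositive — if `σ` moves some element, the reflection `τ` FIXES a
  non-zero element.  Applied to `A = Cl_S(L)[5^∞]`: growth of the class group of `L` beyond the classes coming
  from `F'` (equivalently, by MS03 Cor. 6.4, vanishing of the pairings `⟨ε, ·⟩`) forces `5 ∣ h_S(K_ε)` — the
  growth sits on the `τ̃ = +1` side, which is what the degree-30 computation of §7.11 (14) observes.
-/

namespace Summit.Langlands.Langlands.Theorems

/-- The dihedral sign lemma: `τ = -1`, `τ σ = σ⁻¹ τ` and `σ` of odd order force `σ = 1`. -/
theorem soloInformed_dihedral_sign {A : Type*} [AddCommGroup A] (σ τ : A ≃+ A)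
    (hrel : ∀ a, τ (σ a) = σ.symm (τ a)) (hτ : ∀ a, τ a = -a) {n : ℕ} (hn : Odd n)
    (hσn : ∀ a, (⇑σ)^[n] a = a) : ∀ a, σ a = a := by
  -- `σ` coincides with its inverse
  have h1 : ∀ a, σ a = σ.symm a := by
    intro a
    have h := hrel a
    rw [hτ, hτ, map_neg] at h
    exact neg_injective h
  -- hence `σ ∘ σ = id`
  have h2 : ∀ a, σ (σ a) = a := by
    intro a
    rw [h1 (σ a)]
    exact σ.symm_apply_apply a
  have h2' : (⇑σ)^[2] = id := funext fun a => h2 a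
  obtain ⟨k, rfl⟩ := hn
  intro a
  have h := hσn a
  rw [show 2 * k + 1 = 1 + 2 * k by ring, Function.iterate_add, Function.iterate_mul, h2',
    Function.iterate_id] at h
  simpa using h

/-- If the involution `τ` (with `τ σ = σ⁻¹ τ`, `σ` of odd order) has no non-zero fixed vector, then `σ = 1`. -/
theorem soloInformed_sigma_trivial_of_no_fixed_vector {A : Type*} [AddCommGroup A] (σ τ : A ≃+ A)
    (hrel : ∀ a, τ (σ a) = σ.symm (τ a)) (hτ2 : ∀ a, τ (τ a) = a) {n : ℕ} (hn : Odd n)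
    (hσn : ∀ a, (⇑σ)^[n] a = a) (hfix : ∀ a, τ a = a → a = 0) : ∀ a, σ a = a := by
  have hτ : ∀ a, τ a = -a := by
    intro a
    have hsum : τ (a + τ a) = a + τ a := by rw [map_add, hτ2, add_comm]
    exact eq_neg_of_add_eq_zero_right (hfix _ hsum)
  exact soloInformed_dihedral_sign σ τ hrel hτ hn hσn

/-- Contrapositive, the form used in §7.11 (14): if `σ` moves some element of `A`, then the reflection `τ`
fixes a non-zero element of `A` ("the growth of the class group sits on the `τ = +1` side"). -/
theorem soloInformed_exists_fixed_vector {A : Type*} [AddCommGroup A] (σ τ : A ≃+ A)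
    (hrel : ∀ a, τ (σ a) = σ.symm (τ a)) (hτ2 : ∀ a, τ (τ a) = a) {n : ℕ} (hn : Odd n)
    (hσn : ∀ a, (⇑σ)^[n] a = a) {b : A} (hb : σ b ≠ b) : ∃ a : A, a ≠ 0 ∧ τ a = a := by
  by_contra h
  push Not at h
  exact hb (soloInformed_sigma_trivial_of_no_fixed_vector σ τ hrel hτ2 hn hσn
    (fun a ha => by
      by_contra hne
      exact h a hne ha) b)

end Summit.Langlands.Langlands.Theorems
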